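import Literature.Probability.LatticeModels.PlaneRotatorLiebBoxCriterion
import Literature.Probability.LatticeModels.PlaneRotatorIsingComparisonProof
import HarnessLib

/-!
# Ising input for Lieb's box criterion: the rotator box number is at most the Ising box number at half the
# coupling (Aizenman–Simon), so exact Ising boxes certify rotator decay

E. H. Lieb, Comm. Math. Phys. **77** (1980) 127 [Lieb1980], Theorem 4 and p. 128 (the box criterion `S_R < 1` as
a finite algorithm — tree `twoPoint_le_pow_boxShellSum`, `PlaneRotatorLiebBoxCriterion.lean`); M. Aizenman,
B. Simon, Phys. Lett. **76A** (1980) 281 [AizenmanSimon1980RotorIsing], eq. (1): the plane rotor at inverse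
temperature `2β` is dominated by the Ising model at `β` with the same couplings — a KERNEL theorem of the tree
(`AizenmanSimonRotorIsingComparison_holds`). Composition (one lemma, as recorded on the `hubbard-tc` K5 line):

* `isingBoxShellSum c R` — the **Ising box number**: `∑_{‖b‖_∞ = R} ⟨σ_0 σ_b⟩_{[−R,R]^ν, c, shell free}` for the
  pair-interaction Ising model (`PairIsing.avg`, ordered-pair couplings) on the reference box with the shell–shell
  bonds removed (`refCoupling`); an exactly computable number (transfer matrices), unlike the rotator integral.
* `boxShellSum_le_isingBoxShellSum` — **`S_R^{rotor}(Jf) ≤ S_R^{Ising}(Jf/2)`** for `Jf ≥ 0`.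
* `twoPoint_nn_le_pow_isingBoxShellSum` — the **box criterion with Ising input**: for the nearest-neighbour XY
  model at coupling `K ≥ 0` on any finite `Λ ⊂ ℤ^ν`,
  `⟨cos(θ_a − θ_c)⟩_{Λ,K} ≤ (S_R^{Ising}(K/2))^{⌊‖a − c‖_∞/R⌋}`, the Ising number taken at coupling `K/2` per bond
  (`K/4` per ordered pair); so ONE exact Ising box value `< 1` certifies `K < K_c^{XY}`.

Cell use (`pub/hubbard-tc`, MO-S3, K5 column): the rotor-native box ladder (`R ≤ 4` computable) and mod-1's K5-I
chain (Aizenman–Simon + exact Ising boxes + modified Simon–Lieb) meet: Lieb's refinement on the Ising side feeds the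
rotator box criterion directly. As `R → ∞` this route saturates at `K_c^{XY} ≥ 2K_c^{Ising}` (`T_c^{XY} ≤ 1.1346 J`),
not at `T_KT`. Classical comparison model only; no numerics here.
-/

noncomputable section

open MeasureTheory Finset
open scoped BigOperators

namespace Literature.Probability.LatticeModels

namespace PlaneRotator

section IsingInput

open Literature.Barriers.CriticalPhenomena Literature.Barriers.CriticalPhenomena.LongRangeIsing

variable {ν : ℕ}

/-- The **Ising box number** `S_R^{Ising}(c) = ∑_{‖b‖_∞ = R} ⟨σ_0 σ_b⟩_{[−R,R]^ν, shell free}` of the pair-interaction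
Ising model with ordered-pair couplings `c` (weight `exp(∑_x ∑_y c_{xy} σ_x σ_y)`, tree `PairIsing.avg`) on the
reference box, shell–shell bonds removed. [cite: Lieb1980, Theorem 4 and p. 128 (boxes; the same algorithm for Ising spins)] -/
def isingBoxShellSum (c : Site ν → Site ν → ℝ) (R : ℕ) : ℝ :=
  ∑ b ∈ refShell ν R, PairIsing.avg (fun x y : box ν R => refCoupling c R (x, y)) (spinPair (refCentre ν R) b)

omit ν in
/-- Halving the couplings commutes with removing the shell–shell bonds. [folklore] -/
private theorem refCoupling_half {ν : ℕ} (Jf : Site ν → Site ν → ℝ) (R : ℕ) (p : box ν R × box ν R) :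
    refCoupling Jf R p = 2 * refCoupling (fun x y => Jf x y / 2) R p := by
  unfold refCoupling
  split_ifs <;> ring

variable [MeasurableSpace Circle] [BorelSpace Circle]

/-- **The rotator box number is at most the Ising box number at half the coupling**:
`S_R^{rotor}(Jf) ≤ S_R^{Ising}(Jf/2)` for `Jf ≥ 0` (Aizenman–Simon's comparison, term by term on the shell).
[cite: AizenmanSimon1980RotorIsing, eq. (1); Lieb1980, Theorem 4 and p. 128 (boxes)] -/
theorem boxShellSum_le_isingBoxShellSum {Jf : Site ν → Site ν → ℝ} (hJf0 : ∀ x y, 0 ≤ Jf x y) (R : ℕ) :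
    boxShellSum Jf R ≤ isingBoxShellSum (fun x y => Jf x y / 2) R := by
  classical
  unfold boxShellSum isingBoxShellSum
  refine Finset.sum_le_sum fun b _ => ?_
  have hc : ∀ x y : box ν R, 0 ≤ refCoupling (fun x y => Jf x y / 2) R (x, y) :=
    fun x y => refCoupling_nonneg (fun x y => by have := hJf0 x y; positivity) R _
  have h := AizenmanSimonRotorIsingComparison_holds (box ν R)
    (fun x y : box ν R => refCoupling (fun x y => Jf x y / 2) R (x, y)) hc (refCentre ν R) b
  have hJ : (fun p : box ν R × box ν R => 2 * refCoupling (fun x y => Jf x y / 2) R (p.1, p.2)) =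
      refCoupling Jf R := funext fun p => (refCoupling_half Jf R p).symm
  rw [hJ] at h
  exact h

/-- **Lieb's box criterion with Ising input.** For the nearest-neighbour XY model at coupling `K ≥ 0` on any finite
`Λ ⊂ ℤ^ν` (free boundary conditions), `R ≥ 1` and `a, c ∈ Λ`:
`⟨cos(θ_a − θ_c)⟩_{Λ,K} ≤ (S_R^{Ising})^{⌊‖a − c‖_∞/R⌋}`, where `S_R^{Ising}` is the Ising box number with
`K/4` on each ordered nearest-neighbour pair (coupling `K/2` per bond, Aizenman–Simon's `β` for the rotator's `2β = K`).
One exact Ising box value `< 1` certifies exponential decay, i.e. `K < K_c^{XY}`.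
[cite: Lieb1980, Theorem 4 and p. 128 (boxes; finite algorithm); AizenmanSimon1980RotorIsing, eq. (1)] -/
theorem twoPoint_nn_le_pow_isingBoxShellSum {K : ℝ} (hK : 0 ≤ K) {R : ℕ} (hR : 1 ≤ R) (Λ : Finset (Site ν))
    (a c : Λ) :
    twoPoint (nnXYCoupling K ν Λ) a c ≤
      isingBoxShellSum (fun x y : Site ν => K / 4 * nnCoupling ν x y) R ^ (Site.supNorm ((a : Site ν) - (c : Site ν)) / R) := by
  have hJf0 : ∀ x y : Site ν, 0 ≤ K / 2 * nnCoupling ν x y := fun x y => mul_nonneg (by positivity) (nnCoupling_nonneg _ _)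
  refine (twoPoint_nn_le_pow_boxShellSum hK hR Λ a c).trans ?_
  refine pow_le_pow_left₀ (boxShellSum_nonneg hJf0 R) ?_ _
  have h := boxShellSum_le_isingBoxShellSum hJf0 R
  have hhalf : (fun x y : Site ν => K / 2 * nnCoupling ν x y / 2) = fun x y => K / 4 * nnCoupling ν x y := by
    funext x y; ring
  rw [hhalf] at h
  exact h

end IsingInput

end PlaneRotator

end Literature.Probability.LatticeModels

end
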